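import Summits.NavierStokesRegularity.NavierStokesRegularity.Theorems.ScenarioCensusRowF1ax
import Summits.NavierStokesRegularity.NavierStokesRegularity.Theorems.ScenarioCensusRowA7h
import Summits.NavierStokesRegularity.NavierStokesRegularity.Theorems.DssFarFieldSlavingBlowupTypeIDssProfileSimilarityEnstrophyBeltramiLiouville
import Summits.NavierStokesRegularity.NavierStokesRegularity.Theorems.SqueezeCycleSingularZoomWindow
import Summits.NavierStokesRegularity.NavierStokesRegularity.Theorems.ClockStretchingLawClockCeilingZoomDerivLimit
import Summits.NavierStokesRegularity.NavierStokesRegularity.Theorems.PoloidalWindowDoorPoloidalWindowRigidityVorticityTranslate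
import Summits.NavierStokesRegularity.NavierStokesRegularity.Theorems.HalfSpaceWindowDoorCirculationCarryingRigidityWholeSpaceMaxPrinciple
import Literature.Analysis.FluidPDE.TypeIAncientMild
import Literature.Analysis.FluidPDE.WholeSpaceIBP
import Literature.Analysis.FluidPDE.ClassicalSolutionCalculus
import Literature.Analysis.FluidPDE.VorticityEquation
import Literature.Analysis.FluidPDE.TypeIAncientMildClassical
import HarnessLib
import Summits.NavierStokesRegularity.NavierStokesRegularity.Theorems.ScenarioCensusRowF1Pincer

/-!
# Census row F1, the 2×2 RATE TABLE of the enstrophy density on the fast set (cells F1im / F1id; floors DM / DI) — LINE 26 «rate-table» port, part 1/5: §1 (new part) the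
# MATERIAL and the IDEAL read-outs `matOf θ` / `idlOf θ` (`advOf`, `difOf`, the rate parallelogram), their calculus and dictionary.  The frame of §1, the Eulerian read-outs,
# §2–§6 and §8 of the line are LINES 18/20/22/24/25/27 VERBATIM and are taken BY NAME from the landed ports (names spelled by namespace; not re-declared)

Re-homed for the scenario census (typer seat ns-census-typer-1 g9; the cells F1im / F1id and the floors DM / DI are MEMBERS OF RECORD «DECIDED IN KERNEL IN FILES» of row F1
since census v1.78 (critic idea-crit-3 PASS; ref ns-census-ref g10 PRE-CHECK ✓ §15.23 item 45; lead-presearch label); this port makes them TREE-decided): VERBATIM PORT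
of the NEW declarations (§1 material / ideal read-outs, §7 maximum principles, §9 rows) of ns-idea-3 LINE 26 «rate-table»,
`pub/ideators/ns-idea-3/lines/rate-table/line-rate-table.lean` sha16 99519954933d87d3 (2726 l., lean check rc 0, 0 sorry; the frame of §1, the Eulerian read-outs, §2–§6 and §8
are shared VERBATIM with LINES 18/20/22/24/25/27 and taken BY NAME from the landed ports — not re-declared), split for the 400-line rule into `ScenarioCensusRowF1RateTable`
(§1) → `…RateTableMaxPrinciple` (§7a) → `…RateTableKill` (§7b) → `…RateTableRows` (§9 rows/verdicts) → `…RateTableTop` (§9 corollaries + census KEYS).  Lean text VERBATIM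
in namespace `…Theorems.ScenarioCensus.RateTable` (the line's `…Cruxes.ScenarioCensusRowF1.RateTableLine` re-homed), shared names spelled by namespace (`EulerianPincer.…`,
`LiouvilleSocket.…`, `FrozenTop.…`, `InviscidTop.…`, …); port edits: the bracket lines `section …` / `end …` dropped (no `variable`s), `@[conjecture]` on the residual
`TableSlack` (≡ `ScenarioCensus.Row_F1`, OPEN), one-line docstrings added where missing (gate lint), two `have` statements spell the τ-tool's `lapD` (defeq; proof text
only).  Statements untouched.

No census VALUE is moved here (row F1 stays OPEN-WITH-LINE; the members become TREE-decided by name); NS regularity is NOT proved; `Row_F1` is untouched (zero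
movement, `tableSlack_iff_rowF1`); no summit statement is proved by this file. Lemmas that restate already-landed tree declarations are taken BY NAME (gate lint `dedup.landed`): `materialNonIncreasing_ancient_trivial` = `IntegratedQuench.eq_zero_of_nonIntensifying`.
-/

-- the summit and its single problem share the name `NavierStokesRegularity` (D-0017 nested layout)
set_option linter.dupNamespace false

noncomputable section

open MeasureTheory Set Function Filter TopologicalSpace Metric
open scoped Topology NNReal ENNReal InnerProductSpace RealInnerProductSpace Laplacian

namespace Summit.NavierStokesRegularity.NavierStokesRegularity.Theorems.ScenarioCensus.RateTable

open Literature.Analysis Literature.Analysis.FluidPDE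
open Summit.NavierStokesRegularity.NavierStokesRegularity.Theorems

/-! ### The EULERIAN read-outs (NEW): the fixed-point rate of the enstrophy density against the self-similar rate -/

/-! ### The MATERIAL and the IDEAL read-outs (NEW): the two remaining cells of the 2×2 rate table of `|ω|²` -/

/-- The **ADVECTION pairing** `advOf (v, L, H) = ⟪curl L, curl (H v)⟫` (`= ⟪ω, (v·∇)ω⟫ = ½ (v·∇)|ω|²` at `x` for a `C²`
field with `L = ∇v(x)`, `H = ∇²v(x)`): weight 6. -/
def advOf (v : LiouvilleSocket.E3) (L : LiouvilleSocket.E3 →L[ℝ] LiouvilleSocket.E3) (H : LiouvilleSocket.Hess) : ℝ :=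
  ⟪curlCLM L, curlCLM (H v)⟫

/-- The **DIFFUSION pairing** `difOf (L, K) = ⟪curl L, curl K⟫` (`= ⟪ω, Δω⟫` at `x` for a `C³` field with `L = ∇v(x)`,
`K = Σᵢ D³v(x) eᵢ eᵢ`): weight 6. -/
def difOf (L K : LiouvilleSocket.E3 →L[ℝ] LiouvilleSocket.E3) : ℝ :=
  ⟪curlCLM L, curlCLM K⟫

/-- **MATERIAL ALLOWANCE read-out** (time-dependent, weight 6 jointly with the lag `τ`):
`matOf θ (τ; v, L, H, K) = EulerianPincer.ebbOf θ (τ; v, L, H, K) + advOf (v, L, H) = ⟪curl L, curl K + L (curl L)⟫ − θ τ⁻¹ ‖curl L‖²`;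
at `x`, for a `C³` field, `⟪ω, Δω + (ω·∇)v⟫ − θ|ω|²/τ`, i.e. — through the unit-viscosity vorticity equation —
`½ Dₜ|ω|² − θ |ω|²/τ`: HALF THE MATERIAL (Lagrangian) RATE of the enstrophy density, charged only in excess of the
fraction `θ` of the self-similar rate `|ω|²/τ` (cell `M = S + D` of the rate table). -/
def matOf (θ τ : ℝ) (v : LiouvilleSocket.E3) (L : LiouvilleSocket.E3 →L[ℝ] LiouvilleSocket.E3) (H : LiouvilleSocket.Hess) (K : LiouvilleSocket.E3 →L[ℝ] LiouvilleSocket.E3) : ℝ :=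
  EulerianPincer.ebbOf θ τ v L H K + advOf v L H

/-- **IDEAL ALLOWANCE read-out** (time-dependent, weight 6 jointly with the lag `τ`):
`idlOf θ (τ; v, L, H, K) = EulerianPincer.ebbOf θ (τ; v, L, H, K) − difOf (L, K) = ⟪curl L, L (curl L) − curl (H v)⟫ − θ τ⁻¹ ‖curl L‖²`;
at `x`: `⟪ω, (ω·∇)v − (v·∇)ω⟫ − θ|ω|²/τ` — KINEMATIC (no third derivative survives, no `ν`), i.e. — through the vorticity
equation — `½ ∂ₜ|ω|² − ν⟪ω, Δω⟫ − θ|ω|²/τ`: HALF THE IDEAL-EULER (fixed-point, diffusion-free) RATE of the enstrophy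
density against the self-similar rate (cell `I = S − A` of the rate table). -/
def idlOf (θ τ : ℝ) (v : LiouvilleSocket.E3) (L : LiouvilleSocket.E3 →L[ℝ] LiouvilleSocket.E3) (H : LiouvilleSocket.Hess) (K : LiouvilleSocket.E3 →L[ℝ] LiouvilleSocket.E3) : ℝ :=
  EulerianPincer.ebbOf θ τ v L H K - difOf L K

/-- The material read-out written out. -/
theorem matOf_eq (θ τ : ℝ) (v : LiouvilleSocket.E3) (L : LiouvilleSocket.E3 →L[ℝ] LiouvilleSocket.E3) (H : LiouvilleSocket.Hess) (K : LiouvilleSocket.E3 →L[ℝ] LiouvilleSocket.E3) :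
    matOf θ τ v L H K = ⟪curlCLM L, curlCLM K + L (curlCLM L)⟫ - θ * (τ⁻¹ * ‖curlCLM L‖ ^ 2) := by
  simp only [matOf, EulerianPincer.ebbOf, advOf, FrozenTop.vortOf, inner_add_right, inner_sub_right]
  ring

/-- The ideal read-out written out. -/
theorem idlOf_eq (θ τ : ℝ) (v : LiouvilleSocket.E3) (L : LiouvilleSocket.E3 →L[ℝ] LiouvilleSocket.E3) (H : LiouvilleSocket.Hess) (K : LiouvilleSocket.E3 →L[ℝ] LiouvilleSocket.E3) :
    idlOf θ τ v L H K = ⟪curlCLM L, L (curlCLM L) - curlCLM (H v)⟫ - θ * (τ⁻¹ * ‖curlCLM L‖ ^ 2) := by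
  simp only [idlOf, EulerianPincer.ebbOf, difOf, FrozenTop.vortOf, inner_add_right, inner_sub_right]
  ring

/-- **THE RATE PARALLELOGRAM** (display): `E + S = M + I` — Eulerian + stretching = material + ideal, read-out by read-out
(`S`-cell read-out `⟪curl L, L (curl L)⟫ − θ τ⁻¹‖curl L‖²` = LINE 24's allowance read-out). -/
theorem rate_parallelogram (θ τ : ℝ) (v : LiouvilleSocket.E3) (L : LiouvilleSocket.E3 →L[ℝ] LiouvilleSocket.E3) (H : LiouvilleSocket.Hess) (K : LiouvilleSocket.E3 →L[ℝ] LiouvilleSocket.E3) :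
    EulerianPincer.ebbOf θ τ v L H K + (⟪curlCLM L, L (curlCLM L)⟫ - θ * (τ⁻¹ * ‖curlCLM L‖ ^ 2)) =
      matOf θ τ v L H K + idlOf θ τ v L H K := by
  simp only [matOf, idlOf, EulerianPincer.ebbOf, advOf, difOf, FrozenTop.vortOf, inner_add_right, inner_sub_right]
  ring

/-- `𝒦`-homogeneity of the advection pairing: weight 6. -/
theorem advOf_smul (a : ℝ) (v : LiouvilleSocket.E3) (L : LiouvilleSocket.E3 →L[ℝ] LiouvilleSocket.E3) (H : LiouvilleSocket.Hess) :
    advOf (a • v) (a ^ 2 • L) (a ^ 3 • H) = a ^ 6 * advOf v L H := by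
  simp only [advOf, _root_.smul_apply, ContinuousLinearMap.map_smul, real_inner_smul_left, real_inner_smul_right,
    smul_smul]
  ring

/-- `𝒦`-homogeneity of the diffusion pairing: weight 6. -/
theorem difOf_smul (a : ℝ) (L K : LiouvilleSocket.E3 →L[ℝ] LiouvilleSocket.E3) :
    difOf (a ^ 2 • L) (a ^ 4 • K) = a ^ 6 * difOf L K := by
  simp only [difOf, ContinuousLinearMap.map_smul, real_inner_smul_left, real_inner_smul_right]
  ring

/-- Joint `𝒦`-homogeneity: `matOf θ (τ; a v, a²L, a³H, a⁴K) = a⁶ · matOf θ (a²τ; v, L, H, K)` (`a, τ > 0`). -/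
theorem matOf_smul {a τ : ℝ} (ha : 0 < a) (hτ : 0 < τ) (θ : ℝ) (v : LiouvilleSocket.E3) (L : LiouvilleSocket.E3 →L[ℝ] LiouvilleSocket.E3) (H : LiouvilleSocket.Hess)
    (K : LiouvilleSocket.E3 →L[ℝ] LiouvilleSocket.E3) :
    matOf θ τ (a • v) (a ^ 2 • L) (a ^ 3 • H) (a ^ 4 • K) = a ^ 6 * matOf θ (a ^ 2 * τ) v L H K := by
  rw [matOf, matOf, EulerianPincer.ebbOf_smul ha hτ, advOf_smul]
  ring

/-- Joint `𝒦`-homogeneity: `idlOf θ (τ; a v, a²L, a³H, a⁴K) = a⁶ · idlOf θ (a²τ; v, L, H, K)` (`a, τ > 0`). -/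
theorem idlOf_smul {a τ : ℝ} (ha : 0 < a) (hτ : 0 < τ) (θ : ℝ) (v : LiouvilleSocket.E3) (L : LiouvilleSocket.E3 →L[ℝ] LiouvilleSocket.E3) (H : LiouvilleSocket.Hess)
    (K : LiouvilleSocket.E3 →L[ℝ] LiouvilleSocket.E3) :
    idlOf θ τ (a • v) (a ^ 2 • L) (a ^ 3 • H) (a ^ 4 • K) = a ^ 6 * idlOf θ (a ^ 2 * τ) v L H K := by
  rw [idlOf, idlOf, EulerianPincer.ebbOf_smul ha hτ, difOf_smul]
  ring

/-- Continuity of the advection pairing in the full datum. -/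
theorem continuous_advOf :
    Continuous fun q : ℝ × LiouvilleSocket.E3 × (LiouvilleSocket.E3 →L[ℝ] LiouvilleSocket.E3) × LiouvilleSocket.Hess × (LiouvilleSocket.E3 →L[ℝ] LiouvilleSocket.E3) => advOf q.2.1 q.2.2.1 q.2.2.2.1 := by
  have hc : Continuous (curlCLM : (LiouvilleSocket.E3 →L[ℝ] LiouvilleSocket.E3) →L[ℝ] LiouvilleSocket.E3) := curlCLM.continuous
  have hL : Continuous fun q : ℝ × LiouvilleSocket.E3 × (LiouvilleSocket.E3 →L[ℝ] LiouvilleSocket.E3) × LiouvilleSocket.Hess × (LiouvilleSocket.E3 →L[ℝ] LiouvilleSocket.E3) => curlCLM q.2.2.1 :=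
    hc.comp continuous_snd.snd.fst
  have hH : Continuous fun q : ℝ × LiouvilleSocket.E3 × (LiouvilleSocket.E3 →L[ℝ] LiouvilleSocket.E3) × LiouvilleSocket.Hess × (LiouvilleSocket.E3 →L[ℝ] LiouvilleSocket.E3) => curlCLM (q.2.2.2.1 q.2.1) :=
    hc.comp (continuous_snd.snd.snd.fst.clm_apply continuous_snd.fst)
  exact hL.inner hH

/-- Continuity of the diffusion pairing in the full datum. -/
theorem continuous_difOf :
    Continuous fun q : ℝ × LiouvilleSocket.E3 × (LiouvilleSocket.E3 →L[ℝ] LiouvilleSocket.E3) × LiouvilleSocket.Hess × (LiouvilleSocket.E3 →L[ℝ] LiouvilleSocket.E3) => difOf q.2.2.1 q.2.2.2.2 := by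
  have hc : Continuous (curlCLM : (LiouvilleSocket.E3 →L[ℝ] LiouvilleSocket.E3) →L[ℝ] LiouvilleSocket.E3) := curlCLM.continuous
  have hL : Continuous fun q : ℝ × LiouvilleSocket.E3 × (LiouvilleSocket.E3 →L[ℝ] LiouvilleSocket.E3) × LiouvilleSocket.Hess × (LiouvilleSocket.E3 →L[ℝ] LiouvilleSocket.E3) => curlCLM q.2.2.1 :=
    hc.comp continuous_snd.snd.fst
  have hK : Continuous fun q : ℝ × LiouvilleSocket.E3 × (LiouvilleSocket.E3 →L[ℝ] LiouvilleSocket.E3) × LiouvilleSocket.Hess × (LiouvilleSocket.E3 →L[ℝ] LiouvilleSocket.E3) => curlCLM q.2.2.2.2 :=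
    hc.comp continuous_snd.snd.snd.snd
  exact hL.inner hK

/-- Continuity of the material read-out on `{τ > 0}` (jointly in the lag and the data). -/
theorem continuousOn_matOf (θ : ℝ) :
    ContinuousOn (fun q : ℝ × LiouvilleSocket.E3 × (LiouvilleSocket.E3 →L[ℝ] LiouvilleSocket.E3) × LiouvilleSocket.Hess × (LiouvilleSocket.E3 →L[ℝ] LiouvilleSocket.E3) =>
      matOf θ q.1 q.2.1 q.2.2.1 q.2.2.2.1 q.2.2.2.2) {q | 0 < q.1} :=
  (EulerianPincer.continuousOn_ebbOf θ).add continuous_advOf.continuousOn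

/-- Continuity of the ideal read-out on `{τ > 0}`. -/
theorem continuousOn_idlOf (θ : ℝ) :
    ContinuousOn (fun q : ℝ × LiouvilleSocket.E3 × (LiouvilleSocket.E3 →L[ℝ] LiouvilleSocket.E3) × LiouvilleSocket.Hess × (LiouvilleSocket.E3 →L[ℝ] LiouvilleSocket.E3) =>
      idlOf θ q.1 q.2.1 q.2.2.1 q.2.2.2.1 q.2.2.2.2) {q | 0 < q.1} :=
  (EulerianPincer.continuousOn_ebbOf θ).sub continuous_difOf.continuousOn

/-- Continuity of the advection pairing in the data (no lag). -/
theorem continuous_advOf_fixed :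
    Continuous fun q : LiouvilleSocket.E3 × (LiouvilleSocket.E3 →L[ℝ] LiouvilleSocket.E3) × LiouvilleSocket.Hess × (LiouvilleSocket.E3 →L[ℝ] LiouvilleSocket.E3) => advOf q.1 q.2.1 q.2.2.1 := by
  have hc : Continuous (curlCLM : (LiouvilleSocket.E3 →L[ℝ] LiouvilleSocket.E3) →L[ℝ] LiouvilleSocket.E3) := curlCLM.continuous
  have hL : Continuous fun q : LiouvilleSocket.E3 × (LiouvilleSocket.E3 →L[ℝ] LiouvilleSocket.E3) × LiouvilleSocket.Hess × (LiouvilleSocket.E3 →L[ℝ] LiouvilleSocket.E3) => curlCLM q.2.1 :=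
    hc.comp continuous_snd.fst
  have hH : Continuous fun q : LiouvilleSocket.E3 × (LiouvilleSocket.E3 →L[ℝ] LiouvilleSocket.E3) × LiouvilleSocket.Hess × (LiouvilleSocket.E3 →L[ℝ] LiouvilleSocket.E3) => curlCLM (q.2.2.1 q.1) :=
    hc.comp (continuous_snd.snd.fst.clm_apply continuous_fst)
  exact hL.inner hH

/-- Continuity of the diffusion pairing in the data (no lag). -/
theorem continuous_difOf_fixed :
    Continuous fun q : LiouvilleSocket.E3 × (LiouvilleSocket.E3 →L[ℝ] LiouvilleSocket.E3) × LiouvilleSocket.Hess × (LiouvilleSocket.E3 →L[ℝ] LiouvilleSocket.E3) => difOf q.2.1 q.2.2.2 := by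
  have hc : Continuous (curlCLM : (LiouvilleSocket.E3 →L[ℝ] LiouvilleSocket.E3) →L[ℝ] LiouvilleSocket.E3) := curlCLM.continuous
  have hL : Continuous fun q : LiouvilleSocket.E3 × (LiouvilleSocket.E3 →L[ℝ] LiouvilleSocket.E3) × LiouvilleSocket.Hess × (LiouvilleSocket.E3 →L[ℝ] LiouvilleSocket.E3) => curlCLM q.2.1 :=
    hc.comp continuous_snd.fst
  have hK : Continuous fun q : LiouvilleSocket.E3 × (LiouvilleSocket.E3 →L[ℝ] LiouvilleSocket.E3) × LiouvilleSocket.Hess × (LiouvilleSocket.E3 →L[ℝ] LiouvilleSocket.E3) => curlCLM q.2.2.2 :=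
    hc.comp continuous_snd.snd.snd
  exact hL.inner hK

/-- Continuity in the data at a FIXED lag. -/
theorem continuous_matOf_fixed (θ τ : ℝ) :
    Continuous fun q : LiouvilleSocket.E3 × (LiouvilleSocket.E3 →L[ℝ] LiouvilleSocket.E3) × LiouvilleSocket.Hess × (LiouvilleSocket.E3 →L[ℝ] LiouvilleSocket.E3) => matOf θ τ q.1 q.2.1 q.2.2.1 q.2.2.2 :=
  (EulerianPincer.continuous_ebbOf_fixed θ τ).add continuous_advOf_fixed

/-- Continuity in the data at a fixed lag. -/
theorem continuous_idlOf_fixed (θ τ : ℝ) :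
    Continuous fun q : LiouvilleSocket.E3 × (LiouvilleSocket.E3 →L[ℝ] LiouvilleSocket.E3) × LiouvilleSocket.Hess × (LiouvilleSocket.E3 →L[ℝ] LiouvilleSocket.E3) => idlOf θ τ q.1 q.2.1 q.2.2.1 q.2.2.2 :=
  (EulerianPincer.continuous_ebbOf_fixed θ τ).sub continuous_difOf_fixed

/-- `matOf` vanishes at the zero datum. -/
theorem matOf_zero (θ τ : ℝ) : matOf θ τ 0 0 0 0 = 0 := by simp [matOf, EulerianPincer.ebbOf_zero, advOf]

/-- `idlOf` vanishes at the zero datum. -/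
theorem idlOf_zero (θ τ : ℝ) : idlOf θ τ 0 0 0 0 = 0 := by simp [idlOf, EulerianPincer.ebbOf_zero, difOf]

/-- The advection pairing of `(v, ∇v, ∇²v)(x)` is `⟪ω, (v·∇)ω⟫` at `x` (`C²` fields). -/
theorem adv_eq {v : LiouvilleSocket.E3 → LiouvilleSocket.E3} (hv : ContDiff ℝ 2 v) (x : LiouvilleSocket.E3) :
    ⟪curl v x, convect v (curl v) x⟫ = advOf (v x) (fderiv ℝ v x) (fderiv ℝ (fderiv ℝ v) x) := by
  rw [advOf, FrozenTop.convect_curl_eq hv, IntegratedStretch.curl_apply_eq]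

/-- The diffusion pairing of `(∇v, Σᵢ D³v eᵢ eᵢ)(x)` is `⟪ω, Δω⟫` at `x` (`C³` fields). -/
theorem dif_eq {v : LiouvilleSocket.E3 → LiouvilleSocket.E3} (hv : ContDiff ℝ 3 v) (x : LiouvilleSocket.E3) :
    ⟪curl v x, (Δ (curl v)) x⟫ = difOf (fderiv ℝ v x) (FrozenTop.lapD v x) := by
  rw [difOf, FrozenTop.laplacian_curl_eq hv, IntegratedStretch.curl_apply_eq]

/-- The material read-out of `(v, ∇v, ∇²v, K)(x)` at lag `τ` is `⟪ω, Δω + (ω·∇)v⟫ − θ τ⁻¹ |ω|²` at `x` (`C³` fields). -/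
theorem mat_eq (θ τ : ℝ) {v : LiouvilleSocket.E3 → LiouvilleSocket.E3} (hv : ContDiff ℝ 3 v) (x : LiouvilleSocket.E3) :
    ⟪curl v x, (Δ (curl v)) x + convect (curl v) v x⟫ - θ * (τ⁻¹ * ‖curl v x‖ ^ 2) =
      matOf θ τ (v x) (fderiv ℝ v x) (fderiv ℝ (fderiv ℝ v) x) (FrozenTop.lapD v x) := by
  rw [matOf, ← EulerianPincer.ebb_eq θ τ hv x, ← adv_eq (hv.of_le (by norm_cast)) x]
  simp only [inner_add_right, inner_sub_right]
  ring

/-- The ideal read-out of `(v, ∇v, ∇²v, K)(x)` at lag `τ` is `⟪ω, (ω·∇)v − (v·∇)ω⟫ − θ τ⁻¹ |ω|²` at `x` (`C³` fields). -/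
theorem idl_eq (θ τ : ℝ) {v : LiouvilleSocket.E3 → LiouvilleSocket.E3} (hv : ContDiff ℝ 3 v) (x : LiouvilleSocket.E3) :
    ⟪curl v x, convect (curl v) v x - convect v (curl v) x⟫ - θ * (τ⁻¹ * ‖curl v x‖ ^ 2) =
      idlOf θ τ (v x) (fderiv ℝ v x) (fderiv ℝ (fderiv ℝ v) x) (FrozenTop.lapD v x) := by
  rw [idlOf, ← EulerianPincer.ebb_eq θ τ hv x, ← dif_eq hv x]
  simp only [inner_add_right, inner_sub_right]
  ring

/-- `ν`-normalisation: `ν³ · matOf θ (νσ; u/ν, ∇u/ν, ∇²u/ν, K/ν) = ⟪ω, ν Δω + (ω·∇)u⟫ − θ σ⁻¹ |ω|²`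
(`ν, σ > 0`, `C³` fields): the MATERIAL rate at viscosity `ν`. -/
theorem nu_readout_matOf {ν σ : ℝ} (hν : 0 < ν) (hσ : 0 < σ) (θ : ℝ) {v : LiouvilleSocket.E3 → LiouvilleSocket.E3} (hv : ContDiff ℝ 3 v)
    (x : LiouvilleSocket.E3) :
    ν ^ 3 * matOf θ (ν * σ) (ν⁻¹ • v x) (ν⁻¹ • fderiv ℝ v x) (ν⁻¹ • fderiv ℝ (fderiv ℝ v) x)
      (ν⁻¹ • FrozenTop.lapD v x) =
      ⟪curl v x, ν • (Δ (curl v)) x + convect (curl v) v x⟫ - θ * (σ⁻¹ * ‖curl v x‖ ^ 2) := by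
  have hν' : ν ≠ 0 := hν.ne'
  have hA : ν ^ 3 * advOf (ν⁻¹ • v x) (ν⁻¹ • fderiv ℝ v x) (ν⁻¹ • fderiv ℝ (fderiv ℝ v) x) =
      ⟪curl v x, convect v (curl v) x⟫ := by
    rw [adv_eq (hv.of_le (by norm_cast)) x]
    simp only [advOf, _root_.smul_apply, ContinuousLinearMap.map_smul, real_inner_smul_left, real_inner_smul_right,
      smul_smul]
    field_simp
  rw [matOf, mul_add, EulerianPincer.nu_readout_ebbOf hν hσ θ hv x, hA]
  simp only [inner_add_right, inner_sub_right]
  ring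

/-- `ν`-normalisation: `ν³ · idlOf θ (νσ; u/ν, ∇u/ν, ∇²u/ν, K/ν) = ⟪ω, (ω·∇)u − (u·∇)ω⟫ − θ σ⁻¹ |ω|²` (the right side is
`ν`-FREE: the ideal read-out is kinematic). -/
theorem nu_readout_idlOf {ν σ : ℝ} (hν : 0 < ν) (hσ : 0 < σ) (θ : ℝ) {v : LiouvilleSocket.E3 → LiouvilleSocket.E3} (hv : ContDiff ℝ 3 v)
    (x : LiouvilleSocket.E3) :
    ν ^ 3 * idlOf θ (ν * σ) (ν⁻¹ • v x) (ν⁻¹ • fderiv ℝ v x) (ν⁻¹ • fderiv ℝ (fderiv ℝ v) x)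
      (ν⁻¹ • FrozenTop.lapD v x) =
      ⟪curl v x, convect (curl v) v x - convect v (curl v) x⟫ - θ * (σ⁻¹ * ‖curl v x‖ ^ 2) := by
  have hν' : ν ≠ 0 := hν.ne'
  have hD : ν ^ 3 * difOf (ν⁻¹ • fderiv ℝ v x) (ν⁻¹ • FrozenTop.lapD v x) = ⟪curl v x, ν • (Δ (curl v)) x⟫ := by
    rw [inner_smul_right, dif_eq hv x]
    simp only [difOf, ContinuousLinearMap.map_smul, real_inner_smul_left, real_inner_smul_right]
    field_simp
  rw [idlOf, mul_sub, EulerianPincer.nu_readout_ebbOf hν hσ θ hv x, hD]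
  simp only [inner_add_right, inner_sub_right]
  ring
/-! ### Constant levels; the sharp Type-I constant of a Type-I blow-up -/

/-! ### The vorticity-equation dictionary: dynamic = kinematic for classical solutions -/

end Summit.NavierStokesRegularity.NavierStokesRegularity.Theorems.ScenarioCensus.RateTable

end
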